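import Summits.BirchSwinnertonDyer.Rank1Residual.Additive.PinnedKatoGenusFrameOfClassCSeven
import Summits.BirchSwinnertonDyer.Rank1Residual.Additive.RamifiedSevenGenusKummerColumnOfPsi
import HarnessLib

set_option autoImplicit false

/-!
# `𝒞₇` genus road (crux `EllipticUnitValueSevenOfGZK`, K7r), (S-D-ψ) line steps 2–3 under the gate's APPEND-ONLY rule («deprecate, don't mutate»):
# the Kummer column record WITH (psiK) as an EXTENSION `KummerColumnDataPsi`, the constructor ON A DISPLAYED RECORD `katoGenusFrameOfRecord`
# (= `katoGenusFrameOf` with its `Classical.choice` of the record turned into an argument — `katoGenusFrameOf_eq_ofRecord : … = … rfl`), and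
# ★ (S-D-ψ) AS A THEOREM at `katoGenusFrameOfRecord D.toKummerColumnData` for every `D : KummerColumnDataPsi`

Cell bsd-cm, seat bsd-cm-prr-ty1 g36 (literature-prover); pen D1107 (R2)/(R3), D1112.  The planned in-place v2 of `KummerColumnData` (+ field `psiK`)
BOUNCES at the gate with `theorems.append-only` (a landed structure's body may not change), so the (psiK) enrichment is an EXTENSION record and the
constructor is re-issued ON A DISPLAYED RECORD — which is also the pen's (R3) principle («research-relevant witnesses are DISPLAYED INPUTS of the
constructor»), here for the Kummer column: `katoGenusFrameOfRecord … (D : KummerColumnData …) … d`.  Nothing landed is touched: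
`katoGenusFrameOf … d = katoGenusFrameOfRecord … (kummerColumnDataOf …) d` holds by `rfl`.

CONTENTS.  §1 `structure KummerColumnDataPsi … extends KummerColumnData W Kcm h2 K IK ι₀ 𝔣 d φ` with ONE new field
`psiK : ∀ μ : Kcm, μ ^ 2 = -7 → ∃ b₀ b₁ : Ideal (𝓞 Kcm) → ℤ, ∀ 𝔟, IsTwist 7 𝔣 𝔟 → 2 * CM.heckeCharIdealValue ψ 𝔟 = b₀ 𝔟 + b₁ 𝔟 * ι₀ μ`;
`nonempty_kummerColumnDataPsi` (from `KummerColumnOfPsi.exists_kummerColumn_withPsiK`, p820294: the (H_e) column on the Deuring `ψ` WITH GENERATORS);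
the selector `kummerColumnDataPsiOf` at the constructor's `𝔣 = (s)·(|D|)`.  §2 `def katoGenusFrameOfRecord` — the body of `katoGenusFrameOf` VERBATIM with
`D` an argument; `katoGenusFrameOf_eq_ofRecord` (`rfl`); `rfl` junctions.  §3 ★ `katoGenusFrameOfRecord_psiK` — the `hψ` input of
`KatoExpPadicDatum.ofLaws`/`ofLawsOfUnit` at `Φ := katoGenusFrameOfRecord … D.toKummerColumnData d` is a THEOREM for every `D : KummerColumnDataPsi`
(in the `∃ b₀ b₁` form consumed by `katoExpPadicCompatShape_of_exists_unitLaws`).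

HONEST LABEL: a record extension, a re-issued constructor (definition with a body, copied), `rfl` junctions and one projection theorem; 0 new named
facts, no `sorry`, no `instance` declaration, no notation.  Nothing about Kato's values, `exp*`, (S-D-e2) or (S-D-★′) is proved; no stub closes;
stmt-BirchSwinnertonDyer-19945 OPEN (zp v19, 5 sorries); `X12.CMRamifiedSeven` NOT proved; no summit statement is proved by this seat; BSD claimed
for no curve.

## References
* K. Kato, Astérisque 295 (2004), (15.6.1) (p. 253), §15.7 (pp. 255–256), Prop. 15.9 / (15.9.1) (pp. 258–259), 15.14 (p. 264), (15.16.1) (p. 265).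
  [Kato2004Asterisque]
* J. H. Silverman, *Advanced Topics* (1994), Ch. II Prop. 10.4 (p. 170), Cor. 10.4.1 (a) (p. 171), Thm. 10.5 (b). [SilvermanATAEC1994]
* D. A. Cox (2013), §5.B (5.13). [Cox2013]
-/

noncomputable section

open scoped NumberField TensorProduct
open WeierstrassCurve Field NumberField IsDedekindDomain
open Literature.NumberTheory.IwasawaTheory
open Literature.NumberTheory.GaloisRepresentations Literature.NumberTheory.GaloisRepresentations.LocalWeilDatum
open Literature.NumberTheory.EllipticCurves
open Literature.NumberTheory.EllipticCurves.Rank1Residual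
open Literature.NumberTheory.EllipticCurves.IwasawaAlgebra
open Literature.NumberTheory.EllipticCurves.Kato2004
open Literature.NumberTheory.ComplexMultiplication.EllipticUnits
open Summit.BirchSwinnertonDyer.Rank1Residual

namespace Summit.BirchSwinnertonDyer.Rank1Residual.Additive.GenusSeven

/-! ## §1 The Kummer column record WITH (psiK), as an extension -/

/-- **`KummerColumnDataPsi` — the Kummer elliptic-unit column record of a member TOGETHER WITH the integrality letter (psiK)** of its
Grössencharacter: `KummerColumnData` (p818949) extended by ONE field.  [cite: Kato2004Asterisque, §15.7 (pp. 255–256) and Prop. 15.9 (pp. 258–259)]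
[cite: SilvermanATAEC1994, Ch. II Prop. 10.4 (p. 170) and Cor. 10.4.1 (a) (p. 171)] -/
structure KummerColumnDataPsi (W : WeierstrassCurve ℚ) [W.IsElliptic] [Fact (Nat.Prime 7)]
    (Kcm : Type) [Field Kcm] [NumberField Kcm] (h2 : Module.finrank ℚ Kcm = 2)
    [ContinuousSMul ℤ_[7] ((W.baseChange Kcm).tateModule 7)]
    (K : ZpExtension ℚ 7) {γK : absoluteGaloisGroup Kcm}
    (IK : IwasawaH1DataOver (W.baseChange Kcm) 7 (K.restrictOfFinrankEqTwo (by decide) Kcm h2) γK)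
    (ι₀ : Kcm →+* ℂ) (𝔣 : Ideal (𝓞 Kcm)) (d : ℕ)
    (φ : Isogeny (W.baseChange Kcm) (W.baseChange Kcm)) extends KummerColumnData W Kcm h2 K IK ι₀ 𝔣 d φ where
  /-- (psiK): `2ψ(𝔟) ∈ ℤ + ℤ·ι₀(μ)` on admissible twists, for every square root `μ` of `−7` in `Kcm`. -/
  psiK : ∀ μ : Kcm, μ ^ 2 = -7 → ∃ b₀ b₁ : Ideal (𝓞 Kcm) → ℤ, ∀ 𝔟 : Ideal (𝓞 Kcm), IsTwist 7 𝔣 𝔟 →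
    2 * CM.heckeCharIdealValue ψ 𝔟 = (b₀ 𝔟 : ℂ) + (b₁ 𝔟 : ℂ) * ι₀ μ

/-- **The extended record is inhabited** for `W ∈ 𝒞₇`: `KummerColumnOfPsi.exists_kummerColumn_withPsiK` (the (H_e) column on the Deuring `ψ` WITH
GENERATORS).  Conditional on `h159′, hE, h25, h24i, hM1, hM1′, hG`. [cite: Kato2004Asterisque, (15.6.1) (p. 253), Prop. 15.9 (pp. 258–259)]
[cite: SilvermanATAEC1994, Ch. II Cor. 10.4.1 (a) (p. 171)] -/
theorem nonempty_kummerColumnDataPsi (h159' : CM.prop159_kummerCup_expStar_values)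
    (hE : Literature.NumberTheory.ComplexMultiplication.EllipticUnits.Kato2004.sec155_exists_katoUnitRep)
    (h25 : DeShalit1987.prop25_i_normRelation) (h24i : DeShalit1987.prop24_i_mem_rayClassField)
    (hM1 : CM.rayClassField_le_torsionField) (hM1' : CM.torsionField_le_rayClassField_of_conductor)
    (hG : Gross_conductorExponent_baseChange_eq_two_mul)
    {W : WeierstrassCurve ℚ} [W.IsElliptic] [W.IsGloballyMinimal] [Fact (Nat.Prime 7)] (hC : X12.ClassCSeven W) {d : ℕ}
    (hbad : ∀ (q : ℕ) [Fact q.Prime], q ≠ 7 → (¬ Good W q ↔ q ∣ d)) (hodd : Odd d)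
    (Kcm : Type) [Field Kcm] [NumberField Kcm] (h2 : Module.finrank ℚ Kcm = 2) (s : Kcm) (hs : s ^ 2 = -7)
    (c : Kcm ≃ₐ[ℚ] Kcm) (hc : c ≠ 1) (ι₀ : Kcm →+* ℂ) (hι₀ : ∀ (w : InfinitePlace Kcm) (x : Kcm), ι₀ x = w.embedding x)
    [ContinuousSMul ℤ_[7] ((W.baseChange Kcm).tateModule 7)]
    (K : ZpExtension ℚ 7) (hK : K.IsCyclotomic) {γK : absoluteGaloisGroup Kcm}
    (IK : IwasawaH1DataOver (W.baseChange Kcm) 7 (K.restrictOfFinrankEqTwo (by decide) Kcm h2) γK)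
    (𝔣 : Ideal (𝓞 Kcm)) (h𝔣N : Ideal.absNorm 𝔣 = 7 * d ^ 2) (h𝔣dvd : 𝔣 ∣ Ideal.span {((7 * d : ℕ) : 𝓞 Kcm)})
    (φ : Isogeny (W.baseChange Kcm) (W.baseChange Kcm)) (hφ : ∀ P, φ (φ P) = (-7 : ℤ) • P) :
    Nonempty (KummerColumnDataPsi W Kcm h2 K IK ι₀ 𝔣 d φ) := by
  obtain ⟨W₂, hW₂, hmin, hcs, α, β, e, γ₂, hf, ψ, Ω, 𝔏, euK, hjW₂, hiso, hβα, he, he₁, hψ, hLW, hψf, hpsiK, hΩ, hcol⟩ :=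
    KummerColumnOfPsi.exists_kummerColumn_withPsiK h159' hE h25 h24i hM1 hM1' hG hC hbad hodd Kcm h2 s hs c hc ι₀ hι₀ K hK IK 𝔣 h𝔣N
      h𝔣dvd φ hφ
  haveI := hW₂
  haveI := hmin
  haveI := hcs
  exact ⟨
    { W₂ := W₂, j_W₂ := hjW₂, isIsogenous := hiso, α := α, β := β, e := e, βα := hβα, e_eq := he, γ₂ := γ₂, hf := hf,
      good := he₁, ψ := ψ, ψ_infinityType := hψ, ψ_LSeries := hLW, ψ_conductor := hψf, Ω := Ω, Ω_ne_zero := hΩ, 𝔏 := 𝔏,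
      euK := euK, column := hcol, psiK := hpsiK }⟩

/-! ## §2 The constructor ON A DISPLAYED RECORD -/

section Constructor

variable
  -- the named facts (all EXISTING tree declarations; nothing asserted)
  (hstar : exists_zetaClassPosition_of_rank_le_one) (hGZK : rank_eq_analyticRank_of_analyticRank_le_one)
  (h159' : CM.prop159_kummerCup_expStar_values)
  (hE : Literature.NumberTheory.ComplexMultiplication.EllipticUnits.Kato2004.sec155_exists_katoUnitRep)
  (h25 : DeShalit1987.prop25_i_normRelation) (h24i : DeShalit1987.prop24_i_mem_rayClassField)
  (hM1 : CM.rayClassField_le_torsionField) (hM1' : CM.torsionField_le_rayClassField_of_conductor)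
  (hG : Gross_conductorExponent_baseChange_eq_two_mul) (h155u : Kato2004.kato155_isUnit_of_two_le_primeDivisors)
  -- the member and the cyclotomic datum
  {W : WeierstrassCurve ℚ} [W.IsElliptic] [W.IsGloballyMinimal] [Fact (Nat.Prime 7)] (hC : X12.ClassCSeven W)
  [ContinuousSMul ℤ_[7] (W.tateModule 7)] (K : ZpExtension ℚ 7) (hK : K.IsCyclotomic)
  {γ : absoluteGaloisGroup ℚ} (hγ : K.IsTopGenerator γ) (I : IwasawaH1Data W 7 K γ)
  -- the genus frame OF THE MEMBER
  (F : GenusFrame) (hbad : ∀ (q : ℕ) [Fact q.Prime], q ≠ 7 → (¬ Good W q ↔ q ∣ F.d))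
  -- the CM field block
  (Kcm : Type) [Field Kcm] [NumberField Kcm] (h2 : Module.finrank ℚ Kcm = 2) (s : 𝓞 Kcm) (hs : (s : Kcm) ^ 2 = -7)
  (c : Kcm ≃ₐ[ℚ] Kcm) (hc : c ≠ 1) (ι₀ : Kcm →+* ℂ) (hι₀ : ∀ (w : InfinitePlace Kcm) (x : Kcm), ι₀ x = w.embedding x)
  (e : AlgebraicClosure Kcm →+* AlgebraicClosure ℚ)
  -- the `K`-side carriers and the CM isogeny
  [ContinuousSMul ℤ_[7] ((W.baseChange Kcm).tateModule 7)]
  (γK : absoluteGaloisGroup Kcm) (hγK : (K.restrictOfFinrankEqTwo (by decide) Kcm h2).IsTopGenerator γK)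
  (IK : IwasawaH1DataOver (W.baseChange Kcm) 7 (K.restrictOfFinrankEqTwo (by decide) Kcm h2) γK)
  (φ : Isogeny (W.baseChange Kcm) (W.baseChange Kcm)) (hφ : ∀ P, φ (φ P) = (-7 : ℤ) • P)
  -- the twist and the representatives of Kato's units at the levels `7^{n+1}𝔣`
  (𝔞 : Ideal (𝓞 Kcm)) (h𝔞 : IsTwist 7 (Ideal.span {s} * Ideal.span {((F.d : ℕ) : 𝓞 Kcm)}) 𝔞)
  (hN𝔞 : Ideal.absNorm 𝔞 = F.normA) (z : ℕ → (AlgebraicClosure Kcm)ˣ)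
  (hz : ∀ n : ℕ, IsKatoUnitRep 7 ι₀ (Ideal.span {s} * Ideal.span {((F.d : ℕ) : 𝓞 Kcm)}) (n + 1) 𝔞 (z n))
  -- (H_η): the torsion character pin, DISPLAYED ((S-η) until the F-η bridge `hEta_of_gross1312` lands)
  (hη : ∀ (g₁ : geomTorsion (W.baseChange Kcm) ((7 : ℤ) ^ 1) →+ geomTorsion (W.baseChange Kcm) ((7 : ℤ) ^ 1)),
    (∀ P, ((g₁ P : geomTorsion (W.baseChange Kcm) ((7 : ℤ) ^ 1)) : geomPoints (W.baseChange Kcm)) =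
      φ (P : geomPoints (W.baseChange Kcm))) →
    ∀ (σ : absoluteGaloisGroup Kcm) (a : ℕ) (ζ' : AlgebraicClosure Kcm), e ζ' = F.ζsys 0 → σ • ζ' = ζ' ^ a →
      ∀ P : geomTorsion (W.baseChange Kcm) ((7 : ℤ) ^ 1), g₁ P = 0 →
        σ • (P : geomPoints (W.baseChange Kcm)) =
          ((PadicInt.toZMod ((F.χD (a : ZMod F.d)) * (F.ω (a : ZMod 7)) ^ 5)).val : ℤ) • (P : geomPoints (W.baseChange Kcm)))

  -- the Kummer column record, DISPLAYED
  (D : KummerColumnData W Kcm h2 K IK ι₀ (Ideal.span {s} * Ideal.span {((F.d : ℕ) : 𝓞 Kcm)}) F.d φ)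

/-- ★★★ **`katoGenusFrameOfRecord` — `katoGenusFrameOf` with the Kummer column record an ARGUMENT** (pen D1107 (R3): witnesses displayed): the body of
`katoGenusFrameOf` verbatim with `D` in place of the chosen `kummerColumnDataOf …`.  [cite: Kato2004Asterisque, Prop. 15.9 (15.9.1) (pp. 258–259), 15.14 (p. 264), (15.16.1) (p. 265), Thm. 12.5 (1) (p. 221)]
[cite: NeukirchSchmidtWingberg2008, I §6 (Shapiro)] -/
def katoGenusFrameOfRecord (d : GenusDatum F (normedFamilyOf F Kcm h2 s hs ι₀ e 𝔞 h𝔞 hN𝔞 z hz h155u)) :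
    PinnedKatoGenusFrame W K hK I d :=
  letI instR : Module (QuadOrder (IwasawaAlgebra 7) (-7)) IK.ratH := IK.cmModuleRat hγK φ hφ
  letI := IK.cmModule hγK φ hφ
  let hSC := StarColumn.exists_zetaClassPosition_of_classCSeven hstar hGZK W hC hK hγ I
  let zOne : I.H := hSC.choose
  let k : ℕ := hSC.choose_spec.choose
  { Kcm := Kcm
    finrank_Kcm := h2
    sqrtNegSeven := (s : Kcm)
    sqrtNegSeven_sq := hs
    𝔣 := Ideal.span {s} * Ideal.span {((F.d : ℕ) : 𝓞 Kcm)}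
    absNorm_𝔣 := absNorm_span_sqrt_mul_span_natCast h2 s hs F.d
    𝔣_dvd := span_sqrt_mul_span_natAbs_dvd s hs F.D
    𝔞 := 𝔞
    isTwist_𝔞 := h𝔞
    absNorm_𝔞 := hN𝔞
    R := QuadOrder (IwasawaAlgebra 7) (-7)
    π := QuadOrder.ϖ
    v := -1
    seven_eq := CarrierAlgebra.seven_eq
    A := IK.ratH
    instModule := IK.cmModuleRat hγK φ hφ
    instTower := CarrierAlgebra.isScalarTower h2 W K IK hγK φ hφ
    torsionFree_π := CarrierAlgebra.torsionFree_π h2 W K IK hγK φ hφ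
    frame :=
      { HS := LinearMap.range (IK.toRat hγK φ hφ)
        zeta := (-QuadOrder.ϖ : QuadOrder (IwasawaAlgebra 7) (-7)) ^ memberType W •
            (LocalizedModule.mk (I.resOver IK hγ hγK zOne)
              (⟨(7 : IwasawaAlgebra 7) ^ (k + memberType W), k + memberType W, rfl⟩ : Submonoid.powers (7 : IwasawaAlgebra 7)) :
                IK.ratH)
        -- `x` is the unpinned position element of `Frame1516`; it has no reader (D1098 (Q3)); `KatoExpPadicDatum.xTilde` stands in for it
        x := 0
        EU := fun 𝔟 ↦ LocalizedModule.mkLinearMap (Submonoid.powers (7 : IwasawaAlgebra 7)) IK.H (D.euK 𝔟)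
        EU_mem := fun 𝔟 ↦ CarrierAlgebra.ιS_mem h2 W K IK hγK φ hφ (D.euK 𝔟) }
    j := LocalizedModule.mkLinearMap (Submonoid.powers (7 : IwasawaAlgebra 7)) IK.H ∘ₗ I.resOver IK hγ hγK
    j_mem := CarrierAlgebra.j_mem h2 W K I hγ IK hγK φ hφ
    zS := (-QuadOrder.ϖ : QuadOrder (IwasawaAlgebra 7) (-7)) ^ memberType W •
        (LocalizedModule.mk (I.resOver IK hγ hγK zOne)
          (⟨(7 : IwasawaAlgebra 7) ^ (k + memberType W), k + memberType W, rfl⟩ : Submonoid.powers (7 : IwasawaAlgebra 7)) : IK.ratH)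
    u := 1
    a := memberType W
    a_le_one := memberType_le_one W
    t := 1
    zeta_eq := twistedZS_eq_one_smul h2 W K I hγ IK hγK φ hφ zOne k (memberType W)
    zOne := zOne
    k := k
    zOne_pos := hSC.choose_spec.choose_spec
    j_zOne := j_zOne_of_memberType h2 W K I hγ IK hγK φ hφ zOne k (memberType W)
    EU_not_mem_of_residue :=
      EU_not_mem_of_residue_of_kummerColumn h25 hM1 hM1' h155u K hK F Kcm h2 s hs ι₀ e hγK IK φ hφ 𝔞 h𝔞 hN𝔞 z hz hη D d
    bad_iff_dvd := hbad
    γK := γK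
    isTopGenerator_γK := hγK
    IK := IK
    ιS := LocalizedModule.mkLinearMap (Submonoid.powers (7 : IwasawaAlgebra 7)) IK.H
    ιS_injective := CarrierAlgebra.ιS_injective h2 W K IK
    mem_HS_iff := CarrierAlgebra.mem_HS_iff h2 W K IK hγK φ hφ
    j_eq := CarrierAlgebra.j_eq h2 W K I hγ IK hγK
    φ := φ
    φ_sq := hφ
    proj_pi := CarrierAlgebra.proj_pi h2 W K IK hγK φ hφ
    ψ := D.ψ
    ψ_infinityType := D.ψ_infinityType
    ψ_LSeries := D.ψ_LSeries
    ιC := algClosureEmb ι₀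
    ιC_infinitePlace := fun w x ↦ by rw [algClosureEmb_algebraMap, hι₀ w x]
    ψ_conductor := D.ψ_conductor
    Ω := D.Ω
    Ω_ne_zero := D.Ω_ne_zero
    𝔏 := D.𝔏
    isRayClassLayer_layer := NumberFieldColumn.isRayClassLayer_layer_baseChange h2 K hK W F.d
    euK := D.euK
    euK_spec := fun 𝔟 h𝔟 ↦ by
      haveI := D.isElliptic_W₂
      haveI := D.continuousSMul_W₂
      obtain ⟨uu, -, ⟨y, hy⟩, hproj⟩ := D.column 𝔟 h𝔟
      exact ⟨_, y, hy, hproj⟩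
    EU_eq := fun _ _ ↦ rfl }

variable (d : GenusDatum F (normedFamilyOf F Kcm h2 s hs ι₀ e 𝔞 h𝔞 hN𝔞 z hz h155u))

/-- **`katoGenusFrameOf` IS `katoGenusFrameOfRecord` at the chosen record** (`rfl`). [cite: Kato2004Asterisque, Prop. 15.9 (p. 258)] -/
theorem katoGenusFrameOf_eq_ofRecord :
    katoGenusFrameOf hstar hGZK h159' hE h25 h24i hM1 hM1' hG h155u hC K hK hγ I F hbad Kcm h2 s hs c hc ι₀ hι₀ e γK hγK IK φ hφ 𝔞 h𝔞 hN𝔞 z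
        hz hη d =
      katoGenusFrameOfRecord hstar hGZK h25 hM1 hM1' h155u hC K hK hγ I F hbad Kcm h2 s hs ι₀ hι₀ e γK hγK IK φ hφ 𝔞 h𝔞 hN𝔞 z hz hη
        (kummerColumnDataOf h159' hE h25 h24i hM1 hM1' hG hC K hK F hbad Kcm h2 s hs c hc ι₀ hι₀ γK IK φ hφ) d :=
  rfl

/-- Junctions (`rfl`): the record-fed frame's `Kcm`, `sqrtNegSeven`, `𝔣`, `ιC`, `ψ`, `Ω`, `𝔏`, `euK`, `a`, `u`, `t`.
[cite: Kato2004Asterisque, Prop. 15.9 (p. 258) and (15.16.1) (p. 265)] -/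
theorem katoGenusFrameOfRecord_fields :
    (katoGenusFrameOfRecord hstar hGZK h25 hM1 hM1' h155u hC K hK hγ I F hbad Kcm h2 s hs ι₀ hι₀ e γK hγK IK φ hφ 𝔞 h𝔞 hN𝔞 z hz hη D d).Kcm
        = Kcm ∧
      (katoGenusFrameOfRecord hstar hGZK h25 hM1 hM1' h155u hC K hK hγ I F hbad Kcm h2 s hs ι₀ hι₀ e γK hγK IK φ hφ 𝔞 h𝔞 hN𝔞 z hz hη D
          d).sqrtNegSeven = (s : Kcm) ∧
      (katoGenusFrameOfRecord hstar hGZK h25 hM1 hM1' h155u hC K hK hγ I F hbad Kcm h2 s hs ι₀ hι₀ e γK hγK IK φ hφ 𝔞 h𝔞 hN𝔞 z hz hη D d).𝔣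
        = Ideal.span {s} * Ideal.span {((F.d : ℕ) : 𝓞 Kcm)} ∧
      (katoGenusFrameOfRecord hstar hGZK h25 hM1 hM1' h155u hC K hK hγ I F hbad Kcm h2 s hs ι₀ hι₀ e γK hγK IK φ hφ 𝔞 h𝔞 hN𝔞 z hz hη D d).ιC
        = algClosureEmb ι₀ ∧
      (katoGenusFrameOfRecord hstar hGZK h25 hM1 hM1' h155u hC K hK hγ I F hbad Kcm h2 s hs ι₀ hι₀ e γK hγK IK φ hφ 𝔞 h𝔞 hN𝔞 z hz hη D d).ψ
        = D.ψ ∧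
      (katoGenusFrameOfRecord hstar hGZK h25 hM1 hM1' h155u hC K hK hγ I F hbad Kcm h2 s hs ι₀ hι₀ e γK hγK IK φ hφ 𝔞 h𝔞 hN𝔞 z hz hη D d).Ω
        = D.Ω ∧
      (katoGenusFrameOfRecord hstar hGZK h25 hM1 hM1' h155u hC K hK hγ I F hbad Kcm h2 s hs ι₀ hι₀ e γK hγK IK φ hφ 𝔞 h𝔞 hN𝔞 z hz hη D d).𝔏
        = D.𝔏 ∧
      (katoGenusFrameOfRecord hstar hGZK h25 hM1 hM1' h155u hC K hK hγ I F hbad Kcm h2 s hs ι₀ hι₀ e γK hγK IK φ hφ 𝔞 h𝔞 hN𝔞 z hz hη D d).euK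
        = D.euK ∧
      (katoGenusFrameOfRecord hstar hGZK h25 hM1 hM1' h155u hC K hK hγ I F hbad Kcm h2 s hs ι₀ hι₀ e γK hγK IK φ hφ 𝔞 h𝔞 hN𝔞 z hz hη D d).a
        = memberType W ∧
      (katoGenusFrameOfRecord hstar hGZK h25 hM1 hM1' h155u hC K hK hγ I F hbad Kcm h2 s hs ι₀ hι₀ e γK hγK IK φ hφ 𝔞 h𝔞 hN𝔞 z hz hη D d).u
        = 1 ∧
      (katoGenusFrameOfRecord hstar hGZK h25 hM1 hM1' h155u hC K hK hγ I F hbad Kcm h2 s hs ι₀ hι₀ e γK hγK IK φ hφ 𝔞 h𝔞 hN𝔞 z hz hη D d).t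
        = 1 :=
  ⟨rfl, rfl, rfl, rfl, rfl, rfl, rfl, rfl, rfl, rfl, rfl⟩

/-- **The selector of the EXTENDED record at the constructor's inputs** (`d := F.d`, `𝔣 := (s)·(|D|)`). [cite: Kato2004Asterisque, (15.6.1) (p. 253)] -/
def kummerColumnDataPsiOf : KummerColumnDataPsi W Kcm h2 K IK ι₀ (Ideal.span {s} * Ideal.span {((F.d : ℕ) : 𝓞 Kcm)}) F.d φ :=
  Classical.choice (nonempty_kummerColumnDataPsi h159' hE h25 h24i hM1 hM1' hG hC hbad F.odd_d Kcm h2 (s : Kcm) hs c hc ι₀ hι₀ K hK IK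
    (Ideal.span {s} * Ideal.span {((F.d : ℕ) : 𝓞 Kcm)}) (absNorm_span_sqrt_mul_span_natCast h2 s hs F.d)
    (span_sqrt_mul_span_natCast_dvd_span_seven_mul s hs F.d) φ hφ)

/-! ## §3 ★ (S-D-ψ) AS A THEOREM on the record-fed frame -/

/-- ★ **(S-D-ψ) AT THE RECORD-FED FRAME** — for every extended record `D₂`, the (psiK) input of `KatoExpPadicDatum.ofLaws` / `ofLawsOfUnit` at
`Φ := katoGenusFrameOfRecord … D₂.toKummerColumnData d` HOLDS: `∃ b₀ b₁ : Ideal (𝓞 Kcm) → ℤ, ∀ 𝔟, IsTwist 7 Φ.𝔣 𝔟 → 2·Φ.ψ(𝔟) = b₀ 𝔟 + b₁ 𝔟 · Φ.ιC(Φ.sqrtNegSeven)`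
(`Φ.ψ = D₂.ψ`, `Φ.ιC = algClosureEmb ι₀`, `Φ.sqrtNegSeven = s`, field `psiK` at `μ := s`).  This is the `hψ` argument of
`katoExpPadicCompatShape_of_exists_unitLaws` verbatim, so on the record-fed frame (S-D) ⟸ (S-D-e2) ∧ (∃-form (S-D-★′)).
[cite: SilvermanATAEC1994, Ch. II Prop. 10.4 (p. 170) and Cor. 10.4.1 (a) (p. 171)] [cite: Kato2004Asterisque, §15.7 (pp. 255–256)] [cite: Cox2013, §5.B (5.13)] -/
theorem katoGenusFrameOfRecord_psiK
    (D₂ : KummerColumnDataPsi W Kcm h2 K IK ι₀ (Ideal.span {s} * Ideal.span {((F.d : ℕ) : 𝓞 Kcm)}) F.d φ) :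
    ∃ b₀ b₁ : Ideal (𝓞 Kcm) → ℤ, ∀ 𝔟 : Ideal (𝓞 Kcm),
      IsTwist 7 (katoGenusFrameOfRecord hstar hGZK h25 hM1 hM1' h155u hC K hK hγ I F hbad Kcm h2 s hs ι₀ hι₀ e γK hγK IK φ hφ 𝔞 h𝔞 hN𝔞 z hz
        hη D₂.toKummerColumnData d).𝔣 𝔟 →
      2 * CM.heckeCharIdealValue (katoGenusFrameOfRecord hstar hGZK h25 hM1 hM1' h155u hC K hK hγ I F hbad Kcm h2 s hs ι₀ hι₀ e γK hγK IK φ hφ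
          𝔞 h𝔞 hN𝔞 z hz hη D₂.toKummerColumnData d).ψ 𝔟 =
        (b₀ 𝔟 : ℂ) + (b₁ 𝔟 : ℂ) *
          (katoGenusFrameOfRecord hstar hGZK h25 hM1 hM1' h155u hC K hK hγ I F hbad Kcm h2 s hs ι₀ hι₀ e γK hγK IK φ hφ 𝔞 h𝔞 hN𝔞 z hz hη
              D₂.toKummerColumnData d).ιC
            (algebraMap Kcm (AlgebraicClosure Kcm)
              (katoGenusFrameOfRecord hstar hGZK h25 hM1 hM1' h155u hC K hK hγ I F hbad Kcm h2 s hs ι₀ hι₀ e γK hγK IK φ hφ 𝔞 h𝔞 hN𝔞 z hz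
                hη D₂.toKummerColumnData d).sqrtNegSeven) := by
  obtain ⟨b₀, b₁, h⟩ := D₂.psiK (s : Kcm) hs
  refine ⟨b₀, b₁, fun 𝔟 h𝔟 ↦ ?_⟩
  show 2 * CM.heckeCharIdealValue D₂.ψ 𝔟 = (b₀ 𝔟 : ℂ) + (b₁ 𝔟 : ℂ) * algClosureEmb ι₀ (algebraMap Kcm (AlgebraicClosure Kcm) (s : Kcm))
  rw [algClosureEmb_algebraMap]
  exact h 𝔟 h𝔟

end Constructor

end Summit.BirchSwinnertonDyer.Rank1Residual.Additive.GenusSeven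

end
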